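import Summits.QuantumFields.QCD.Theorems.NestedDissectionSeaEarlyCrosserLawCurvatureBound
import Summits.QuantumFields.QCD.Theorems.NestedDissectionSeaKineticEdge
import Literature.MathematicalPhysics.QuantumLattice.WilsonCellSchur

/-!
# Curvature bound for Dirichlet-cell early crossers (crux `EarlyCrosserLaw`, stmt-QuantumFields-13995)

Line `cells-inherit-torus-extinction`, lead c5 (`prover-line-stmt-QuantumFields-13995-c5-0`).

The landed lattice Weitzenböck bound (`CurvatureBound.plaquetteDefect_le_quadForm`, p134187) says
that the `v`-weighted plaquette defect of ANY torus field `v` is at most `96 · Re⟨v, D_W(U,0,1) v⟩`.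
Clause (a′) of the crux is about DIRICHLET CELLS: the charged object is a kernel vector `w` of the cell
matrix `wilsonCell U μ' x t` (the cell is singular at bare mass `μ'`; it is an EARLY crosser for
flavour `f` iff `μ' ≥ m_f(k)`, i.e. `−μ' ≤ |m_crit(k)| − a_k m_f/Z_m(k)`, which tends to `0` on the
physical branch). This file transfers the bound to cells by zero extension:

* `cellKernel_linkDefect_eq`: for a kernel vector `w` of the cell at `μ'`, the total squared covariant
  link defect of its zero extension `ŵ` is EXACTLY `2(−μ')‖w‖²` (the kinetic identity
  `Re⟨ŵ, D_W(U,μ',1) ŵ⟩ = μ'‖ŵ‖² + ½ Σ |link defect|²` of `re_quadForm_wilsonDirac_eq_wilsonTerm`, and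
  `⟨ŵ, D_W(U,μ',1) ŵ⟩ = ⟨w, D_c w⟩ = 0` because the cell acts on `w` as `D_W` acts on `ŵ`);
* `cellKernel_plaquetteDefect_le`: hence the `ŵ`-weighted plaquette defect over the whole torus —
  i.e. over the plaquettes based at sites of the box, weighted by `|w|²` there — is at most
  `96 (−μ') ‖w‖²`.

Reading for the crux: an early crosser (`−μ' ≤ |m_crit(k)|`, `→ 0` on the branch) sees every
plaquette where it lives trivial to precision `96 |m_crit(k)|` in the `|w|²`-weighted mean — the
deterministic half of "carriers of early real modes are covariantly smooth" that both S2′ (quasimode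
carriers) and S3′ (sheet-attached carriers) presuppose. The probabilistic half (how rare such smooth
carriers are ABOVE the pinned line) is the open content of the stubs. Tree definitions only; no named
facts. [folklore]
-/

noncomputable section

open Matrix Complex
open scoped ComplexConjugate BigOperators
open Literature.MathematicalPhysics.QuantumLattice Literature.MathematicalPhysics.QuantumFieldTheory
  Literature.Probability.LatticeModels
open Summit.QuantumFields.QCD.Theorems.KineticEdge (sum_dite_subtype)
open Summit.QuantumFields.QCD.Theorems.HeatSlicedQuarksAccretiveWilsonDirac
  (re_quadForm_wilsonDirac_eq_wilsonTerm)

namespace Summit.QuantumFields.QCD.Cruxes.EarlyCrosserLaw.CurvatureBound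

/-- **The cell acts on `w` as `D_W` acts on its zero extension** (entries inside the box): for
`ŵ i = w i` on the box and `0` outside, `(D_W(U,μ,1) ŵ) i = (D_c w) i` for every box index `i`
(the cell matrix is the principal submatrix `Matrix.toSquareBlockProp`). [folklore] -/
theorem mulVec_zeroExt_eq_wilsonCell_mulVec {N : ℕ} [NeZero N] (U : GaugeConfig 4 N SU3) (μ : ℝ) (x : TorusSite 4 N)
    (t : Fin 4 → ℕ) [Fintype {a // wilsonBox x t a}] (w : {a // wilsonBox x t a} → ℂ)
    (i : {a // wilsonBox x t a}) :
    (wilsonDirac (fundamentalRep (Fin 3)) U μ 1 *ᵥ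
        fun q => if h : wilsonBox x t q then w ⟨q, h⟩ else 0) i =
      (wilsonCell U μ x t *ᵥ w) i := by
  set D := wilsonDirac (fundamentalRep (Fin 3)) U μ 1 with hD
  set v : TorusSite 4 N × Fin 3 × Fin 4 → ℂ := fun q => if h : wilsonBox x t q then w ⟨q, h⟩ else 0
    with hv
  have hvp : ∀ j : {a // wilsonBox x t a}, v j = w j := fun j => by simp [hv, j.2]
  have hvn : ∀ j, ¬ wilsonBox x t j → v j = 0 := fun j hj => by simp [hv, hj]
  simp only [Matrix.mulVec, dotProduct, wilsonCell, Matrix.toSquareBlockProp_def, Matrix.of_apply]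
  have hR : (∑ j : {a // wilsonBox x t a}, D (i : TorusSite 4 N × Fin 3 × Fin 4) j * w j) =
      ∑ j ∈ Finset.univ.filter (wilsonBox x t), D (i : TorusSite 4 N × Fin 3 × Fin 4) j * v j := by
    rw [Finset.sum_subtype (Finset.univ.filter (wilsonBox x t)) (p := wilsonBox x t)
      (fun j => by simp)]
    exact Finset.sum_congr rfl fun j _ => by rw [hvp j]
  rw [hR, Finset.sum_filter]
  refine Finset.sum_congr rfl fun j _ => ?_
  by_cases hj : wilsonBox x t j
  · simp [hj]
  · simp [hj, hvn j hj]

/-- **Quadratic form of the zero extension of a kernel vector vanishes**: if `D_c w = 0` then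
`Σ_i conj(ŵ i) (D_W(U,μ',1) ŵ) i = 0`. [folklore] -/
theorem quadForm_zeroExt_eq_zero_of_kernel {N : ℕ} [NeZero N] (U : GaugeConfig 4 N SU3) (μ' : ℝ) (x : TorusSite 4 N)
    (t : Fin 4 → ℕ) (w : {a // wilsonBox x t a} → ℂ) (hw : wilsonCell U μ' x t *ᵥ w = 0) :
    (∑ i, conj ((fun q => if h : wilsonBox x t q then w ⟨q, h⟩ else (0 : ℂ)) i) *
        (wilsonDirac (fundamentalRep (Fin 3)) U μ' 1 *ᵥ
          fun q => if h : wilsonBox x t q then w ⟨q, h⟩ else 0) i) = 0 := by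
  set v : TorusSite 4 N × Fin 3 × Fin 4 → ℂ := fun q => if h : wilsonBox x t q then w ⟨q, h⟩ else 0
    with hv
  have hvn : ∀ j, ¬ wilsonBox x t j → v j = 0 := fun j hj => by simp [hv, hj]
  have hterm : ∀ i, conj (v i) * (wilsonDirac (fundamentalRep (Fin 3)) U μ' 1 *ᵥ v) i =
      if h : wilsonBox x t i then
        conj (w ⟨i, h⟩) * (wilsonCell U μ' x t *ᵥ w) ⟨i, h⟩ else 0 := by
    intro i
    by_cases hi : wilsonBox x t i
    · rw [dif_pos hi, ← mulVec_zeroExt_eq_wilsonCell_mulVec U μ' x t w ⟨i, hi⟩]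
      simp [hv, hi]
    · rw [dif_neg hi, hvn i hi, map_zero, zero_mul]
  simp_rw [hterm]
  rw [sum_dite_subtype (wilsonBox x t) (instp := inferInstance)
    (fun a => conj (w a) * (wilsonCell U μ' x t *ᵥ w) a), hw]
  simp

/-- **Norm of the zero extension**: `Σ_i |ŵ i|² = Σ_q |w q|²`. [folklore] -/
theorem sum_norm_sq_zeroExt {N : ℕ} [NeZero N] (x : TorusSite 4 N) (t : Fin 4 → ℕ) (w : {a // wilsonBox x t a} → ℂ) :
    ∑ i, ‖(fun q => if h : wilsonBox x t q then w ⟨q, h⟩ else (0 : ℂ)) i‖ ^ 2 = ∑ q, ‖w q‖ ^ 2 := by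
  have : ∀ i, ‖(fun q => if h : wilsonBox x t q then w ⟨q, h⟩ else (0 : ℂ)) i‖ ^ 2 =
      if h : wilsonBox x t i then ‖w ⟨i, h⟩‖ ^ 2 else 0 := by
    intro i
    by_cases hi : wilsonBox x t i
    · simp [hi]
    · simp [hi]
  simp_rw [this]
  exact sum_dite_subtype (wilsonBox x t) (instp := inferInstance) (fun a => ‖w a‖ ^ 2)

/-- **Link defect of a cell kernel vector (exact).** If the Dirichlet cell of the box `(x,t)` is
singular at bare mass `μ'` with kernel vector `w`, the total squared covariant link defect of the zero
extension `ŵ` is `Σ_{y,μ,a,α} |Σ_b ρ(U(y,μ))_{ab} ŵ(y+μ̂,b,α) − ŵ(y,a,α)|² = 2 (−μ') Σ_q |w q|²`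
(kinetic identity at mass `μ'` with vanishing quadratic form). In particular `μ' ≤ 0`: a cell can only
cross at non-positive bare mass (the numerical-range fact behind `KineticEdge`). [folklore] -/
theorem cellKernel_linkDefect_eq {N : ℕ} [NeZero N] (U : GaugeConfig 4 N SU3) (μ' : ℝ)
    (x : TorusSite 4 N) (t : Fin 4 → ℕ) (w : {a // wilsonBox x t a} → ℂ)
    (hw : wilsonCell U μ' x t *ᵥ w = 0) :
    ∑ y : TorusSite 4 N, ∑ μ : Fin 4, ∑ a : Fin 3, ∑ α : Fin 4,
        ‖(∑ b : Fin 3, fundamentalRep (Fin 3) (U (y, μ)) a b *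
            (fun q => if h : wilsonBox x t q then w ⟨q, h⟩ else (0 : ℂ)) (Site.shift y μ, b, α)) -
          (fun q => if h : wilsonBox x t q then w ⟨q, h⟩ else (0 : ℂ)) (y, a, α)‖ ^ 2 =
      2 * (-μ') * ∑ q, ‖w q‖ ^ 2 := by
  have hkin := re_quadForm_wilsonDirac_eq_wilsonTerm (fundamentalRep (Fin 3))
    fundamentalRep_mem_unitaryGroup U μ' (fun q => if h : wilsonBox x t q then w ⟨q, h⟩ else (0 : ℂ))
  have h0 := quadForm_zeroExt_eq_zero_of_kernel U μ' x t w hw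
  have hstar : (∑ i, star ((fun q => if h : wilsonBox x t q then w ⟨q, h⟩ else (0 : ℂ)) i) *
      (wilsonDirac (fundamentalRep (Fin 3)) U μ' 1 *ᵥ
        fun q => if h : wilsonBox x t q then w ⟨q, h⟩ else 0) i) = 0 := h0
  rw [hstar, Complex.zero_re, sum_norm_sq_zeroExt] at hkin
  linarith

/-- **A cell can only cross at non-positive bare mass** (`μ' ≤ 0` for a non-zero kernel vector;
corollary of `cellKernel_linkDefect_eq`). [folklore] -/
theorem cellKernel_mass_nonpos {N : ℕ} [NeZero N] (U : GaugeConfig 4 N SU3) (μ' : ℝ) (x : TorusSite 4 N)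
    (t : Fin 4 → ℕ) (w : {a // wilsonBox x t a} → ℂ) (hw : wilsonCell U μ' x t *ᵥ w = 0)
    (hw0 : w ≠ 0) : μ' ≤ 0 := by
  have h := cellKernel_linkDefect_eq U μ' x t w hw
  have hpos : 0 < ∑ q, ‖w q‖ ^ 2 := by
    obtain ⟨q, hq⟩ : ∃ q, w q ≠ 0 := Function.ne_iff.mp hw0
    have hq' : 0 < ‖w q‖ ^ 2 := by positivity
    have hle : ‖w q‖ ^ 2 ≤ ∑ q, ‖w q‖ ^ 2 :=
      Finset.single_le_sum (f := fun q => ‖w q‖ ^ 2) (fun i _ => by positivity) (Finset.mem_univ q)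
    exact lt_of_lt_of_le hq' hle
  have hnn : 0 ≤ 2 * (-μ') * ∑ q, ‖w q‖ ^ 2 := by rw [← h]; positivity
  nlinarith

/-- **Curvature bound for a Dirichlet-cell crosser (Weitzenböck, cell form).** If the Dirichlet cell
of the box `(x,t)` is singular at bare mass `μ'` with kernel vector `w`, then the `|w|²`-weighted
plaquette defect — summed over all plaquettes `(y,μ,ν)` based at box sites `y`, all spins `α` —
satisfies `Σ_{y,μ,ν,α} Σ_a |ŵ(y,a,α) − (U_□(y,μ,ν) ŵ(y,·,α))(a)|² ≤ 96 (−μ') Σ_q |w q|²`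
(`plaquetteDefect_le_quadForm` for the zero extension `ŵ`, whose form at mass `0` equals
`(−μ')‖w‖²`). For an EARLY crosser of clause (a′) (`−μ' ≤ |m_crit(k)| − a_k m_f/Z_m(k) → 0` on the
physical branch) the gauge field is flat to precision `96 |m_crit(k)|` wherever the mode lives. [folklore] -/
theorem cellKernel_plaquetteDefect_le {N : ℕ} [NeZero N] (U : GaugeConfig 4 N SU3) (μ' : ℝ)
    (x : TorusSite 4 N) (t : Fin 4 → ℕ) (w : {a // wilsonBox x t a} → ℂ)
    (hw : wilsonCell U μ' x t *ᵥ w = 0) :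
    ∑ y : TorusSite 4 N, ∑ μ : Fin 4, ∑ ν : Fin 4, ∑ α : Fin 4, ∑ a : Fin 3,
        ‖(fun q => if h : wilsonBox x t q then w ⟨q, h⟩ else (0 : ℂ)) (y, a, α) -
          ((fundamentalRep (Fin 3) (plaquetteHolonomy U y μ ν)) *ᵥ
            (fun b => (fun q => if h : wilsonBox x t q then w ⟨q, h⟩ else (0 : ℂ)) (y, b, α))) a‖ ^ 2 ≤
      96 * (-μ') * ∑ q, ‖w q‖ ^ 2 := by
  set v : TorusSite 4 N × Fin 3 × Fin 4 → ℂ := fun q => if h : wilsonBox x t q then w ⟨q, h⟩ else 0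
    with hv
  have hP := plaquetteDefect_le_quadForm U v
  -- the form at mass `0` equals `(−μ')‖w‖²`: kinetic identity at `0` and at `μ'`
  have hkin0 := re_quadForm_wilsonDirac_eq_wilsonTerm (fundamentalRep (Fin 3))
    fundamentalRep_mem_unitaryGroup U 0 v
  have hlink := cellKernel_linkDefect_eq U μ' x t w hw
  have hre : (∑ i, conj (v i) * (wilsonDirac (fundamentalRep (Fin 3)) U 0 1 *ᵥ v) i).re =
      (-μ') * ∑ q, ‖w q‖ ^ 2 := by
    have : (∑ i, conj (v i) * (wilsonDirac (fundamentalRep (Fin 3)) U 0 1 *ᵥ v) i) =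
        ∑ i, star (v i) * (wilsonDirac (fundamentalRep (Fin 3)) U 0 1 *ᵥ v) i := rfl
    rw [this, hkin0, zero_mul, zero_add, hlink]
    ring
  rw [hre] at hP
  calc _ ≤ 96 * ((-μ') * ∑ q, ‖w q‖ ^ 2) := hP
    _ = 96 * (-μ') * ∑ q, ‖w q‖ ^ 2 := by ring

end Summit.QuantumFields.QCD.Cruxes.EarlyCrosserLaw.CurvatureBound

end
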